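import Summits.CriticalPhenomena.CardyFormulaZ2.Theorems.CardyQContinuationIsingJetsConformalStubLoopSymmetricNormalForms
import Summits.CriticalPhenomena.CardyFormulaZ2.Theorems.CardyQContinuationIsingJetsConformalStubUpperComparison
import Summits.CriticalPhenomena.CardyFormulaZ2.Theorems.CardyQContinuationIsingJetsConformalStubCsLimitAlongSequence
import Summits.CriticalPhenomena.CardyFormulaZ2.Theorems.CardyQContinuationIsingJetsConformalStubHarmonicMeasureAlongSequence

/-!
# Crux `IsingJetsConformal`, stub `stub_loopSymmetricLimit_assemblyUpper`:
# the upper half of the `n = 0` bridge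
# (route `CardyQContinuation`, item stmt-CriticalPhenomena-5560)

Fix a conformal rectangle `R` with uniformizing datum `(φ, x)`, `η = crossRatio x`, and `κ > 0`.
Write `LS_δ = N_δ(√2) / (N_δ(√2) + √2 (Z^joint_δ(√2) - N_δ(√2)))` for the loop-symmetric
critical FK-Ising crossing ratio of the tree's discretisation `Ω_δ` of `R`
(`fkTwoArcCrossingPolynomial`, `fkTwoArcPartitionPolynomials`) and `p = fkIsingCrossingFunction`.
Assuming the Chelkak–Smirnov crossing theorem (`ChelkakSmirnov2012_fkIsingQuadrilateralCrossing`,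
a hypothesis) and the DESIGN⁺ hypothesis (for every `τ > 0` an approximant `Rp` of `R` with
`τ`-close conformal modulus and, eventually as `δ → 0⁺`, a glued Chelkak–Smirnov discrete
quadrilateral `E` whose polygonal domain `Q` is `C δ`-close to `Rp` in Radó's sense together with
the gluing zone `Z₀ ⊔ Z₂` of `stub_loopSymmetricLimit_upperComparison`), we prove
`∀ᶠ δ in 𝓝[>] 0, LS_δ < p η + κ`.

Proof. `p` is continuous (`FkIsingCrossingFunctionProps.fkIsingCrossingFunction_continuous`):
choose `τ` with `|η' - η| < τ → |p η' - p η| < κ`, and the DESIGN⁺ data `Rp, C`. For a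
uniformizing datum `(φp, xp)` of `Rp` (`MarkedDomain.exists_isUniformizing_holds`)
`p (crossRatio xp) < p η + κ`. If the claim failed, `𝓝[>] 0` being countably generated there
would be a sequence `δ_k → 0⁺` in the good set with `LS_{δ_k} ≥ p η + κ`
(`Filter.exists_seq_forall_of_frequently`). Along it: the normal forms
(`stub_loopSymmetricLimit_normalForms`) and the upper comparison
(`stub_loopSymmetricLimit_upperComparison`, at `p = √2/(1+√2)`, `q = 2`) give
`LS_{δ_k} ≤ csCrossingProb (E_k)`; the `C δ_k`-closeness gives Radó convergence `Q_k → Rp`, the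
input `stub_loopSymmetricLimit_harmonicMeasureAlongSequence` gives uniform radii and a uniform
harmonic-measure lower bound, and `stub_loopSymmetricLimit_csLimitAlongSequence` gives
`csCrossingProb (E_k) → p (crossRatio xp) < p η + κ` — a contradiction.

References: D. Chelkak, S. Smirnov, Invent. Math. 189 (2012), Thm. 6.1; G. Grimmett,
*The Random-Cluster Model* (2006), §4.2. No new definitions, no named fact beyond the hypotheses.
-/

namespace Summit.CriticalPhenomena.CardyFormulaZ2.Theorems.CardyQContinuation

open Set Metric Filter MeasureTheory Polynomial
open scoped Topology
open Literature.Analysis.Potential (harmonicMeasure)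
open Literature.Probability.RandomPlanarGeometry
open Literature.Probability.LatticeModels
open Literature.Probability.Percolation

noncomputable section

namespace AssemblyUpper

/-- Uniform convergence from a uniform `O(δ_k)` bound: if `dist (F k t) (f t) ≤ C δ_k` for all
`k, t` and `δ_k → 0`, then `F k → f` uniformly. [folklore] -/
theorem tendstoUniformly_of_dist_le {F : ℕ → ℝ → ℂ} {f : ℝ → ℂ} {C : ℝ} {δ : ℕ → ℝ}
    (hδ : Tendsto δ atTop (𝓝 0)) (h : ∀ k t, dist (F k t) (f t) ≤ C * δ k) :
    TendstoUniformly F f atTop := by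
  refine Metric.tendstoUniformly_iff.2 fun ε hε ↦ ?_
  have hC : Tendsto (fun k ↦ C * δ k) atTop (𝓝 0) := by simpa using hδ.const_mul C
  filter_upwards [hC.eventually_lt_const hε] with k hk t
  rw [dist_comm]
  exact (h k t).trans_lt hk

/-- Convergence from an `O(δ_k)` bound: if `dist (g k) a ≤ C δ_k` and `δ_k → 0`, then `g k → a`.
[folklore] -/
theorem tendsto_of_dist_le {g : ℕ → ℂ} {a : ℂ} {C : ℝ} {δ : ℕ → ℝ}
    (hδ : Tendsto δ atTop (𝓝 0)) (h : ∀ k, dist (g k) a ≤ C * δ k) : Tendsto g atTop (𝓝 a) := by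
  have hC : Tendsto (fun k ↦ C * δ k) atTop (𝓝 0) := by simpa using hδ.const_mul C
  exact tendsto_iff_dist_tendsto_zero.2 (squeeze_zero (fun k ↦ dist_nonneg) h hC)

/-- The self-dual FK-Ising edge density `p = √2/(1+√2)` lies in `[0, 1]`. [folklore] -/
theorem selfDualParam_mem_Icc : Real.sqrt 2 / (1 + Real.sqrt 2) ∈ Icc (0 : ℝ) 1 := by
  have h2 : (0 : ℝ) < Real.sqrt 2 := Real.sqrt_pos.2 two_pos
  exact ⟨div_nonneg h2.le (by positivity), (div_le_one (by positivity)).2 (by linarith)⟩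

/-- The self-dual FK-Ising edge density `p = √2/(1+√2)` is `< 1`. [folklore] -/
theorem selfDualParam_lt_one : Real.sqrt 2 / (1 + Real.sqrt 2) < 1 := by
  have h2 : (0 : ℝ) < Real.sqrt 2 := Real.sqrt_pos.2 two_pos
  exact (div_lt_one (by positivity)).2 (by linarith)

/-- The FK-Ising cluster weight `q = √2 ^ 2 = 2` is `≥ 1`. [folklore] -/
theorem one_le_sqrt_two_sq : (1 : ℝ) ≤ Real.sqrt 2 ^ 2 := by
  rw [Real.sq_sqrt zero_le_two]
  norm_num

/-- **One mesh of the upper comparison in loop-symmetric form.** For `δ > 0` and a glued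
Chelkak–Smirnov quadrilateral `(E, d₀, n)` with gluing zone `Z₀ ⊔ Z₂` as in
`stub_loopSymmetricLimit_upperComparison`, the loop-symmetric ratio of `Ω_δ` is at most the
Chelkak–Smirnov crossing probability `csCrossingProb E d₀ n`: both are `f` of self-dual
random-cluster crossing probabilities (`stub_loopSymmetricLimit_normalForms`), `f` is increasing on
`[0, 1]`, and the probabilities compare by `stub_loopSymmetricLimit_upperComparison`.
[cite: Grimmett2006, §4.2 Lemma (4.13)] -/
theorem loopSymmetric_le_csCrossingProb (R : ConformalRectangle) {δ : ℝ} (hδ : 0 < δ)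
    (E : Finset (Sym2 (Site 2))) (d₀ : Site 2 × Fin 4) (n : Fin 4 → ℕ) (Z₀ Z₂ : Set (Site 2))
    (hdisj : Disjoint Z₀ Z₂) (hW0 : discreteArc R.carrier δ (R.arc 0) ⊆ Z₀)
    (hW2 : discreteArc R.carrier δ (R.arc 2) ⊆ Z₂) (hB0 : DiscreteRect.blackVerts E d₀ n 0 ⊆ Z₀)
    (hB2 : DiscreteRect.blackVerts E d₀ n 2 ⊆ Z₂)
    (hfar : ∀ x ∈ Z₀, ∀ y ∈ Z₂, ¬ (discreteDomainGraph R.carrier δ).Adj x y ∧ s(x, y) ∉ E)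
    (hblack : ∀ v ∈ Z₀ ∪ Z₂, v ∈ (DiscreteRect.verts E : Set (Site 2)) →
      v ∈ DiscreteRect.blackVerts E d₀ n 0 ∪ DiscreteRect.blackVerts E d₀ n 2)
    (hoff : ∀ v, v ∈ meshDomain R.carrier δ ∪ (DiscreteRect.verts E : Set (Site 2)) →
      v ∉ Z₀ ∪ Z₂ → v ∈ (DiscreteRect.verts E : Set (Site 2)) ∧
        v ∉ DiscreteRect.blackVerts E d₀ n 0 ∪ DiscreteRect.blackVerts E d₀ n 2)
    (hmiss : ∀ x y : Site 2, (discreteDomainGraph R.carrier δ).Adj x y → s(x, y) ∉ E →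
      x ∈ Z₀ ∪ Z₂) :
    aeval (Real.sqrt 2) (fkTwoArcCrossingPolynomial R δ ArcWiring.joint) /
        (aeval (Real.sqrt 2) (fkTwoArcCrossingPolynomial R δ ArcWiring.joint) +
          Real.sqrt 2 * (aeval (Real.sqrt 2) (fkTwoArcPartitionPolynomials R δ ArcWiring.joint) -
            aeval (Real.sqrt 2) (fkTwoArcCrossingPolynomial R δ ArcWiring.joint))) ≤
      DiscreteRect.csCrossingProb E d₀ n := by
  classical
  haveI := (meshDomain_finite R.isBounded hδ).fintype
  have hp := selfDualParam_mem_Icc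
  have hq0 : (0 : ℝ) < Real.sqrt 2 ^ 2 := one_pos.trans_le one_le_sqrt_two_sq
  obtain ⟨h1, h2, h3⟩ := stub_loopSymmetricLimit_normalForms
  rw [h1 R δ hδ, h2 E d₀ n]
  haveI := isProbabilityMeasure_fkDomainMeasure R.carrier δ hp hq0 (R.arc 0 ∪ R.arc 2)
  haveI := isProbabilityMeasure_rcMeasure (DiscreteRect.graph E) hp hq0
    ({x | x.1 ∈ DiscreteRect.blackVerts E d₀ n 0} ∪ {x | x.1 ∈ DiscreteRect.blackVerts E d₀ n 2})
  exact h3.monotoneOn ⟨measureReal_nonneg, measureReal_le_one⟩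
    ⟨measureReal_nonneg, measureReal_le_one⟩
    (stub_loopSymmetricLimit_upperComparison R δ _ _ hδ hp selfDualParam_lt_one one_le_sqrt_two_sq
      E d₀ n Z₀ Z₂ hdisj hW0 hW2 hB0 hB2 hfar hblack hoff hmiss)

/-- **The upper assembly, with the harmonic-measure input as a hypothesis.** Assuming the
statement of `stub_loopSymmetricLimit_harmonicMeasureAlongSequence` (uniform radii and a uniform
harmonic-measure lower bound along a Radó-convergent sequence of conformal rectangles), the
Chelkak–Smirnov crossing theorem and the DESIGN⁺ hypothesis imply
`∀ᶠ δ in 𝓝[>] 0, LS_δ < p η + κ` (see the module docstring for the proof).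
[cite: ChelkakSmirnov2012Ising, Thm. 6.1] -/
theorem eventually_lt_of_harmonicMeasureAlongSequence
    (hHM : ∀ (R : ConformalRectangle) (Q : ℕ → ConformalRectangle),
      TendstoUniformly (fun n ↦ (Q n).boundary) R.boundary atTop →
      (∀ i : Fin 4, Tendsto (fun n ↦ (Q n).pt i) atTop (𝓝 (R.pt i))) →
      ∀ z₀ ∈ R.carrier, ∃ r Rad t : ℝ, 0 < r ∧ 0 < Rad ∧ 0 < t ∧ ∀ᶠ n in atTop,
        Metric.ball z₀ r ⊆ (Q n).carrier ∧ (Q n).carrier ⊆ Metric.ball z₀ Rad ∧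
          ∀ i : Fin 4, t ≤ harmonicMeasure (Q n).carrier z₀ ((Q n).arc i))
    (hCS : ChelkakSmirnov2012_fkIsingQuadrilateralCrossing)
    (hD : ∀ (R : ConformalRectangle) (τ : ℝ), 0 < τ → ∃ (Rp : ConformalRectangle) (C : ℝ),
      (∀ (φ : ConformalEquiv UpperHalfPlane.upperHalfPlaneSet R.carrier) (x : Fin 4 → ℝ),
        R.IsUniformizing φ x →
        ∀ (φ' : ConformalEquiv UpperHalfPlane.upperHalfPlaneSet Rp.carrier) (x' : Fin 4 → ℝ),
          Rp.IsUniformizing φ' x' → |crossRatio x' - crossRatio x| < τ) ∧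
      ∀ᶠ δ in 𝓝[>] (0 : ℝ), ∃ (E : Finset (Sym2 (Site 2))) (d₀ : Site 2 × Fin 4)
        (n : Fin 4 → ℕ) (Q : ConformalRectangle) (Z₀ Z₂ : Set (Site 2)),
        DiscreteRect.IsCSQuadrilateral E d₀ n ∧ DiscreteRect.csDomain E d₀ n δ = Q.carrier ∧
        (∀ j : Fin 4, Q.pt j = meshPoint δ (DiscreteRect.csCorner E d₀ n j)) ∧
        Q.arc 0 ⊆ DiscreteRect.blackArc E d₀ n δ 0 ∧ Q.arc 2 ⊆ DiscreteRect.blackArc E d₀ n δ 2 ∧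
        (∀ t : ℝ, dist (Q.boundary t) (Rp.boundary t) ≤ C * δ) ∧
        (∀ j : Fin 4, dist (Q.pt j) (Rp.pt j) ≤ C * δ) ∧ Disjoint Z₀ Z₂ ∧
        discreteArc R.carrier δ (R.arc 0) ⊆ Z₀ ∧ discreteArc R.carrier δ (R.arc 2) ⊆ Z₂ ∧
        DiscreteRect.blackVerts E d₀ n 0 ⊆ Z₀ ∧ DiscreteRect.blackVerts E d₀ n 2 ⊆ Z₂ ∧
        (∀ x ∈ Z₀, ∀ y ∈ Z₂, ¬ (discreteDomainGraph R.carrier δ).Adj x y ∧ s(x, y) ∉ E) ∧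
        (∀ v ∈ Z₀ ∪ Z₂, v ∈ (DiscreteRect.verts E : Set (Site 2)) →
          v ∈ DiscreteRect.blackVerts E d₀ n 0 ∪ DiscreteRect.blackVerts E d₀ n 2) ∧
        (∀ v, v ∈ meshDomain R.carrier δ ∪ (DiscreteRect.verts E : Set (Site 2)) →
          v ∉ Z₀ ∪ Z₂ → v ∈ (DiscreteRect.verts E : Set (Site 2)) ∧
            v ∉ DiscreteRect.blackVerts E d₀ n 0 ∪ DiscreteRect.blackVerts E d₀ n 2) ∧
        (∀ x y : Site 2, (discreteDomainGraph R.carrier δ).Adj x y → s(x, y) ∉ E →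
          x ∈ Z₀ ∪ Z₂))
    (R : ConformalRectangle) (φ : ConformalEquiv UpperHalfPlane.upperHalfPlaneSet R.carrier)
    (x : Fin 4 → ℝ) (hφ : R.IsUniformizing φ x) (κ : ℝ) (hκ : 0 < κ) :
    ∀ᶠ δ in 𝓝[>] (0 : ℝ),
      aeval (Real.sqrt 2) (fkTwoArcCrossingPolynomial R δ ArcWiring.joint) /
          (aeval (Real.sqrt 2) (fkTwoArcCrossingPolynomial R δ ArcWiring.joint) +
            Real.sqrt 2 * (aeval (Real.sqrt 2) (fkTwoArcPartitionPolynomials R δ ArcWiring.joint) -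
              aeval (Real.sqrt 2) (fkTwoArcCrossingPolynomial R δ ArcWiring.joint))) <
        fkIsingCrossingFunction (crossRatio x) + κ := by
  -- continuity of `p` at `η`, the approximant `Rp` and one of its uniformizing data
  obtain ⟨τ, hτ, hτp⟩ := Metric.continuousAt_iff.1
    (FkIsingCrossingFunctionProps.fkIsingCrossingFunction_continuous.continuousAt :
      ContinuousAt fkIsingCrossingFunction (crossRatio x)) κ hκ
  obtain ⟨Rp, C, hcr, hev⟩ := hD R τ hτ
  obtain ⟨φp, xp, hφp⟩ := MarkedDomain.exists_isUniformizing_holds Rp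
  have hlt : fkIsingCrossingFunction (crossRatio xp) <
      fkIsingCrossingFunction (crossRatio x) + κ := by
    have h : dist (fkIsingCrossingFunction (crossRatio xp))
        (fkIsingCrossingFunction (crossRatio x)) < κ :=
      hτp (show dist (crossRatio xp) (crossRatio x) < τ by
        rw [Real.dist_eq]; exact hcr φ x hφ φp xp hφp)
    rw [Real.dist_eq] at h
    linarith [(abs_lt.1 h).2]
  -- argue by contradiction along a sequence `δ_k → 0⁺` in the good set where the claim fails
  by_contra hne
  obtain ⟨δs, hδs, hall⟩ := exists_seq_forall_of_frequently
    ((not_eventually.1 hne).and_eventually (eventually_mem_nhdsWithin.and hev))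
  choose hnot hmem E d₀ nn Q Z₀ Z₂ hq hcar hpt harc0 harc2 hbd hptd hdisj hW0 hW2 hB0 hB2 hfar
    hblack hoff hmiss using hall
  have hpos : ∀ k, 0 < δs k := fun k ↦ Set.mem_Ioi.1 (hmem k)
  have hδ0 : Tendsto δs atTop (𝓝 0) := hδs.mono_right nhdsWithin_le_nhds
  -- Radó convergence `Q_k → Rp`
  have hJ : TendstoUniformly (fun k ↦ (Q k).boundary) Rp.boundary atTop :=
    tendstoUniformly_of_dist_le hδ0 hbd
  have hptc : ∀ i : Fin 4, Tendsto (fun k ↦ (Q k).pt i) atTop (𝓝 (Rp.pt i)) := fun i ↦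
    tendsto_of_dist_le hδ0 fun k ↦ hptd k i
  -- uniform radii and harmonic-measure bound, then the Chelkak–Smirnov limit along the sequence
  obtain ⟨z₀, hz₀⟩ := Rp.nonempty
  obtain ⟨r, Rad, t, hr, hRad, ht, hgeom⟩ := hHM Rp Q hJ hptc z₀ hz₀
  have hlim := stub_loopSymmetricLimit_csLimitAlongSequence hCS Rp Q δs E d₀ nn hpos hδ0 hq hcar
    hpt (fun k ↦ ⟨harc0 k, harc2 k⟩) hJ hptc ⟨z₀, r, Rad, t, hr, hRad, ht, hgeom⟩ φp xp hφp
  obtain ⟨k, hk⟩ := (hlim.eventually_lt_const hlt).exists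
  exact hnot k ((loopSymmetric_le_csCrossingProb R (hpos k) (E k) (d₀ k) (nn k) (Z₀ k) (Z₂ k)
    (hdisj k) (hW0 k) (hW2 k) (hB0 k) (hB2 k) (hfar k) (hblack k) (hoff k) (hmiss k)).trans_lt hk)

end AssemblyUpper

open AssemblyUpper in
/-- **Registered stub `stub_loopSymmetricLimit_assemblyUpper`** of the `n = 0` bridge of the crux
`IsingJetsConformal` (stmt-CriticalPhenomena-5560), the UPPER half: assuming the Chelkak–Smirnov
crossing theorem `ChelkakSmirnov2012_fkIsingQuadrilateralCrossing` and the DESIGN⁺ hypothesis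
(approximants `Rp` of `R` with `τ`-close modulus carrying, eventually in the mesh `δ → 0⁺`, glued
Chelkak–Smirnov discrete quadrilaterals `C δ`-close to `Rp` with the gluing zone of
`stub_loopSymmetricLimit_upperComparison`), for every conformal rectangle `R` with uniformizing
datum `(φ, x)` and every `κ > 0`, eventually as `δ → 0⁺` the loop-symmetric critical FK-Ising
crossing ratio `N_δ(√2) / (N_δ(√2) + √2 (Z^joint_δ(√2) - N_δ(√2)))` of `Ω_δ` is
`< fkIsingCrossingFunction (crossRatio x) + κ`. Proof:
`AssemblyUpper.eventually_lt_of_harmonicMeasureAlongSequence` with the landed input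
`stub_loopSymmetricLimit_harmonicMeasureAlongSequence`.
[cite: ChelkakSmirnov2012Ising, Thm. 6.1] -/
theorem stub_loopSymmetricLimit_assemblyUpper :
    (Literature.Probability.LatticeModels.ChelkakSmirnov2012_fkIsingQuadrilateralCrossing → (∀ (R : Literature.Probability.RandomPlanarGeometry.ConformalRectangle) (τ : ℝ), 0 < τ → ∃ (Rp : Literature.Probability.RandomPlanarGeometry.ConformalRectangle) (C : ℝ), (∀ (φ : Literature.Probability.RandomPlanarGeometry.ConformalEquiv UpperHalfPlane.upperHalfPlaneSet R.carrier) (x : Fin 4 → ℝ), R.IsUniformizing φ x → ∀ (φ' : Literature.Probability.RandomPlanarGeometry.ConformalEquiv UpperHalfPlane.upperHalfPlaneSet Rp.carrier) (x' : Fin 4 → ℝ), Rp.IsUniformizing φ' x' → |Literature.Probability.RandomPlanarGeometry.crossRatio x' - Literature.Probability.RandomPlanarGeometry.crossRatio x| < τ) ∧ ∀ᶠ δ in nhdsWithin (0 : ℝ) (Set.Ioi 0), ∃ (E : Finset (Sym2 (Literature.Probability.LatticeModels.Site 2))) (d₀ : Literature.Probability.LatticeModels.Site 2 × Fin 4) (n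 : Fin 4 → ℕ) (Q : Literature.Probability.RandomPlanarGeometry.ConformalRectangle) (Z₀ Z₂ : Set (Literature.Probability.LatticeModels.Site 2)), Literature.Probability.LatticeModels.DiscreteRect.IsCSQuadrilateral E d₀ n ∧ Literature.Probability.LatticeModels.DiscreteRect.csDomain E d₀ n δ = Q.carrier ∧ (∀ j : Fin 4, Q.pt j = Literature.Probability.LatticeModels.meshPoint δ (Literature.Probability.LatticeModels.DiscreteRect.csCorner E d₀ n j)) ∧ Q.arc 0 ⊆ Literature.Probability.LatticeModels.DiscreteRect.blackArc E d₀ n δ 0 ∧ Q.arc 2 ⊆ Literature.Probability.LatticeModels.DiscreteRect.blackArc E d₀ n δ 2 ∧ (∀ t : ℝ, dist (Q.boundary t) (Rp.boundary t) ≤ C * δ) ∧ (∀ j : Fin 4, dist (Q.pt j) (Rp.pt j) ≤ C * δ) ∧ Disjoint Z₀ Z₂ ∧ Literature.Probability.LatticeModels.discreteArc R.carrier δ (R.arc 0) ⊆ Z₀ ∧ Literature.Probability.LatticeModels.discreteArc R.carrier δ (R.arc 2) ⊆ Z₂ ∧ Literature.Probability.LatticeModels.DiscreteRect.blackVerts E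 d₀ n 0 ⊆ Z₀ ∧ Literature.Probability.LatticeModels.DiscreteRect.blackVerts E d₀ n 2 ⊆ Z₂ ∧ (∀ x ∈ Z₀, ∀ y ∈ Z₂, ¬ (Literature.Probability.LatticeModels.discreteDomainGraph R.carrier δ).Adj x y ∧ s(x, y) ∉ E) ∧ (∀ v ∈ Z₀ ∪ Z₂, v ∈ (Literature.Probability.LatticeModels.DiscreteRect.verts E : Set (Literature.Probability.LatticeModels.Site 2)) → v ∈ Literature.Probability.LatticeModels.DiscreteRect.blackVerts E d₀ n 0 ∪ Literature.Probability.LatticeModels.DiscreteRect.blackVerts E d₀ n 2) ∧ (∀ v, v ∈ Literature.Probability.LatticeModels.meshDomain R.carrier δ ∪ (Literature.Probability.LatticeModels.DiscreteRect.verts E : Set (Literature.Probability.LatticeModels.Site 2)) → v ∉ Z₀ ∪ Z₂ → v ∈ (Literature.Probability.LatticeModels.DiscreteRect.verts E : Set (Literature.Probability.LatticeModels.Site 2)) ∧ v ∉ Literature.Probability.LatticeModels.DiscreteRect.blackVerts E d₀ n 0 ∪ Literature.Probability.LatticeModels.DiscreteRect.blackVerts E d₀ n 2) ∧ (∀ x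 y : Literature.Probability.LatticeModels.Site 2, (Literature.Probability.LatticeModels.discreteDomainGraph R.carrier δ).Adj x y → s(x, y) ∉ E → x ∈ Z₀ ∪ Z₂)) → ∀ (R : Literature.Probability.RandomPlanarGeometry.ConformalRectangle) (φ : Literature.Probability.RandomPlanarGeometry.ConformalEquiv UpperHalfPlane.upperHalfPlaneSet R.carrier) (x : Fin 4 → ℝ), R.IsUniformizing φ x → ∀ κ : ℝ, 0 < κ → ∀ᶠ δ in nhdsWithin (0 : ℝ) (Set.Ioi 0), Polynomial.aeval (Real.sqrt 2) (Literature.Probability.LatticeModels.fkTwoArcCrossingPolynomial R δ Literature.Probability.LatticeModels.ArcWiring.joint) / (Polynomial.aeval (Real.sqrt 2) (Literature.Probability.LatticeModels.fkTwoArcCrossingPolynomial R δ Literature.Probability.LatticeModels.ArcWiring.joint) + Real.sqrt 2 * (Polynomial.aeval (Real.sqrt 2) (Literature.Probability.LatticeModels.fkTwoArcPartitionPolynomials R δ Literature.Probability.LatticeModels.ArcWiring.joint) - Polynomial.aeval (Real.sqrt 2) (Literature.Probability.LatticeModels.fkTwoArcCrossingPolynomial R δ Literature.Probability.LatticeModels.ArcWiring.joint)))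 < Literature.Probability.LatticeModels.fkIsingCrossingFunction (Literature.Probability.RandomPlanarGeometry.crossRatio x) + κ) := by
  intro hCS hD R φ x hφ κ hκ
  exact eventually_lt_of_harmonicMeasureAlongSequence
    stub_loopSymmetricLimit_harmonicMeasureAlongSequence hCS hD R φ x hφ κ hκ

end

end Summit.CriticalPhenomena.CardyFormulaZ2.Theorems.CardyQContinuation
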